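import Summits.Langlands.Langlands.Theses.RootDecomp1

/-!
# Glue of the layer-2 split of `CuspidalAvatarIrreducible` (route RootDecomp1) — target
`Summits/Langlands/Langlands/Theorems/RootDecomp1CuspidalAvatarIrreducibleOfSplit.lean`

Closes the glue item `CuspidalAvatarIrreducible_of_split : RegularMonodromyPlaceIrreducible → NoRegularMonodromyIrreducible →
CuspidalAvatarIrreducible` generated by
`ledger route edit route-Langlands-RootDecomp1 --split CuspidalAvatarIrreducible --into children.json … --glue-decl-name
CuspidalAvatarIrreducible_of_split` (lens-2-g7 node `MonodromyPlaceDichotomy`, decomp-langlands, 2026-08-30).  To be proposed AFTER the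
split edit lands (the two children and the glue item must exist in `Theses/RootDecomp1.lean`, which then also imports
`Literature.NumberTheory.Automorphic.IwahoriGL` through the children's per-item `imports` key), `--supports <glue item>`, exactly as
`RootDecomp1SemisimpleAvatarOfSplit.lean` closed stmt-Langlands-29153.  Certified beforehand against a VERBATIM copy of the route file of
record (rev 4, ledger commit fbddac77dd61) extended by the children exactly as the gate renders them (`MonodromyPlaceDichotomy.kit_check.lean`,
rc 0 · 0 sorry · axioms propext / Classical.choice / Quot.sound).  PURE LOGIC: strong induction on the rank `n` (the NRM-cell carries the
induction hypothesis «Irr at every rank m < n, all number fields» as an inlined hypothesis) and ONE excluded middle on the INLINED dial RM(π)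
(«some local component of π is essentially square-integrable and Iwahori-spherical after a smooth twist», i.e. π_v ≃ St_n ⊗ χ): RM → RM-cell;
¬RM → NRM-cell fed with the induction hypothesis.  No W⁺, no sibling item, 0 EQUIV, no definitions, no new mathematics.  (If the children are
filed on `route-Langlands-RetentionCarving` instead — it wants the same item stmt-Langlands-23601 — replace `RootDecomp1` by `RetentionCarving`
in the import and in the qualified name; the proof text is unchanged.)
-/

set_option linter.dupNamespace false -- project-wide option; `Summit.Langlands.Langlands` is the mandated namespace

namespace Summit.Langlands.Langlands.Theorems

open scoped Classical
open Filter
open Summit.Langlands.Langlands.Theses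

/-- The glue item of the lens-2-g7 split of `RootDecomp1.CuspidalAvatarIrreducible` (Irr, stmt-Langlands-23601): the two children
`RegularMonodromyPlaceIrreducible` (RM-cell) and `NoRegularMonodromyIrreducible` (NRM-cell, carrying the rank induction hypothesis) imply
the parent, by strong induction on the rank and cases on the inlined dial. -/
theorem CuspidalAvatarIrreducible_of_split_proof :
    Summit.Langlands.Langlands.Theses.RootDecomp1.CuspidalAvatarIrreducible_of_split := by
  intro hRM hNRM
  suffices h : ∀ (m : ℕ), ∀ (K : Type) [Field K] [NumberField K] (hcpt : Literature.NumberTheory.Automorphic.isCompact_glFiniteIntegralLevel m K), 0 < m → ∀ (π : Literature.NumberTheory.Automorphic.CuspidalAutomorphicRepData m K hcpt), π.1.IsLAlgebraic → ∀ (ℓ : ℕ) [Fact ℓ.Prime] (ι : PadicAlgCl ℓ ≃+* ℂ) (ρ : Literature.NumberTheory.GaloisRepresentations.FramedGaloisRep K (PadicAlgCl ℓ) m), ρ.toGaloisRep.IsSemisimple → (∀ᶠ v : IsDedekindDomain.HeightOneSpectrum (NumberField.RingOfIntegers K) in cofinite, SatakeFrobCompatibleAt ι π.1 ρ v) → ρ.toGaloisRep.IsIrreducible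 from
    fun K _ _ n hcpt hn π hL ℓ _ ι ρ hss hρ => h n K hcpt hn π hL ℓ ι ρ hss hρ
  intro m
  induction m using Nat.strong_induction_on with
  | _ n ih =>
    intro K _ _ hcpt hn π hL ℓ _ ι ρ hss hρ
    by_cases hrm : (∃ (v : IsDedekindDomain.HeightOneSpectrum (NumberField.RingOfIntegers K)) (πv : Literature.NumberTheory.Automorphic.SmoothIrrep (Matrix.GeneralLinearGroup (Fin n) (v.adicCompletion K))), π.1.HasLocalComponentAt v πv.ρ ∧ (∀ [MeasurableSpace (Matrix.GeneralLinearGroup (Fin n) (v.adicCompletion K) ⧸ Subgroup.center (Matrix.GeneralLinearGroup (Fin n) (v.adicCompletion K)))] [BorelSpace (Matrix.GeneralLinearGroup (Fin n) (v.adicCompletion K) ⧸ Subgroup.center (Matrix.GeneralLinearGroup (Fin n) (v.adicCompletion K)))] (μ : MeasureTheory.Measure (Matrix.GeneralLinearGroup (Fin n) (v.adicCompletion K) ⧸ Subgroup.center (Matrix.GeneralLinearGroup (Fin n) (v.adicCompletion K)))) [μ.IsHaarMeasure], πv.ρ.IsEssentiallyDiscreteSeries μ) ∧ ∃ χ : Matrix.GeneralLinearGroup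 (Fin n) (v.adicCompletion K) →* ℂˣ, IsOpen (χ.ker : Set (Matrix.GeneralLinearGroup (Fin n) (v.adicCompletion K))) ∧ ∃ w : πv.V, w ≠ 0 ∧ ∀ g ∈ Literature.NumberTheory.Automorphic.iwahoriGL n (v.adicCompletion K), (πv.ρ.twist χ) g w = w)
    · exact hRM K n hcpt hn π hL hrm ℓ ι ρ hss hρ
    · exact hNRM K n hcpt hn π hL hrm (fun m hm => ih m hm) ℓ ι ρ hss hρ

end Summit.Langlands.Langlands.Theorems
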